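import Mathlib
import HarnessLib
import Summits.HubbardSuperconductivity.HubbardSuperconductivity.Theorems.KLProgrammeKLRegimeEngineLastStepAliasRowsSqrt
import Summits.HubbardSuperconductivity.HubbardSuperconductivity.Theorems.KLProgrammeKLRegimeSplitLatticeScaleThreshold
import Summits.HubbardSuperconductivity.HubbardSuperconductivity.Theorems.KLProgrammeKLRegimeSplitFrameDegreeGuard

/-!
# K3 gen-8-FLOW (stmt 20437, stub (C), located item #20, cure (δ′) «LAST-STEP SWAP», layer F3g⁗′): THE LAST-STEP ALIAS ROWS WITH A GRADED ORDER-`s` ENVELOPE —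
# located «(C)-S-ROW-GRADING» (cell gate-hubbard-kl, seat p2 g21, KL STATUS 2026-08-28 15:26Z)

The door of record `lastResponse_bracket_flow_final_sqrt` (p637552) reads the order-`s` alias tails of the two moment data (`Ms_b`, `Ms_c`) through the
UNGRADED envelope `Ms ≤ Ns` (row `…LastStepAliasRowsSqrt.lastAliasRowB_le_sqrt`: `… ≤ Mm·√Rsq⁸U¹⁸/(2⁶β²) + Ms·U⁴/(2^217β¹²)`, then
`…LastStepAliasRowsCore.graded_envelope_le` with `Ms ≤ N′`).  But `Ms = Σ_x (1+|x̃₀|+|x̃₁|)^s‖𝔉⁻¹[datum](x)‖` is a PLAIN lattice moment of a scale-`N+1`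
two-leg datum whose position kernel has range `Λ_N⁻¹ = 32·4^N` (`N = n_β`), so its natural size is `≍ C_s·(32·4^N)^s × (order-0 mass)` — the law the same
door grants the orders `j ≤ 4` (`Mm j ≤ Nm·(4^N)^j`) — and `4^N ≍ β/(32π)` is not uniform in `β ≤ e^{c/U²}`: a β-uniform `Ns` does not exist for the
natural supplier.  This file GRADES the `s`-row: with `Ms ≤ N′·(4^N)^s` the far part keeps `(4^N·4/L)^{s−10} ≤ 1` (from `klEngL₃ ≤ klEngL₄ ≤ L`,
`16·4^N ≤ β/(2π)`) instead of discarding `(4/L)^{s−10}`, and `(4^N)^{10} ≤ β^{10}/2^{65}` (`l_sq_le`) is paid by the `β^{12}` of `X⁴`, `X = U/(2^59β³)`: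

* §1 `nonneg_of_le_mul_pow`, `l_pow_ten_le` (`((4^N)^{10} ≤ β^{10}/2^{65}`), `four_pow_nScales_mul_four_div_le_one` (`4^N·(4/L) ≤ 1` at `klEngL₄ ≤ L`);
* §2 `farPartB_le_graded` (`≤ N′·l^{10}·((285/4)·4⁶·X⁴)` for `Ms ≤ N′·l^s`, `1 ≤ l`, `l·(4/L) ≤ 1`), `rowBoundB_le_graded`
  (`Mm·(1869885·Q) + N′·l^{10}·((285/4)·4⁶·X⁴) ≤ Mm·(Rsq⁸U¹⁸/(2⁶β²)) + N′·(U⁴/(2^282β²))`), `graded_envelope_le_graded`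
  (`… ≤ (N·Rsq⁸/2⁶ + N′/2^282)·(U³/β²)·lʲ`);
* §3 **`lastAliasRowB_le_graded`** — the literal channel-`b`/`c` row (same left-hand side as `lastAliasRowB_le_sqrt`):
  `≤ Mm·(√(klEngRsq R)⁸U¹⁸/(2⁶β²)) + N′·(U⁴/(2^282β²))` under `Ms ≤ N′·((4:ℝ)^{n_β})^s`.

So the U-row coefficient of the alias tail IMPROVES (`Ns/2^217 → N′/2^282`) while `N′` becomes the GRADED, β-free coefficient (natural size `≍ U·C_s·32^s`).
Pure real arithmetic + one threshold fact; no definitions; nothing about the model's sizes is asserted; nothing asserts superconductivity.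
References: BGM 2006 §2.3 (2.21)–(2.24), §2.4 (2.36)–(2.42) [cite: BenfattoGiulianiMastropietro2006].
-/

noncomputable section

namespace Summit.HubbardSuperconductivity.HubbardSuperconductivity.Theorems.EngineV8

set_option linter.dupNamespace false -- summit = problem name (single-conjunct summit), D-0017
set_option exponentiation.threshold 512 -- the graded far-part constant is `2^282`

open Real Finset Literature.MathematicalPhysics.QuantumLattice Literature.Probability.LatticeModels
open Summit.HubbardSuperconductivity.HubbardSuperconductivity.Theorems.KLRegimeSplit
open Summit.HubbardSuperconductivity.HubbardSuperconductivity.Theorems.DispersionFlow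
open Summit.HubbardSuperconductivity.HubbardSuperconductivity.Theorems.KLProgrammeLegKernels
open scoped Nat

/-! ## §1 Three small facts -/

/-- If `0 ≤ Ms ≤ N′·lˢ` with `1 ≤ l` then `0 ≤ N′`. -/
theorem nonneg_of_le_mul_pow {Ms N' l : ℝ} {s : ℕ} (hMs : 0 ≤ Ms) (hl : 1 ≤ l) (h : Ms ≤ N' * l ^ s) : 0 ≤ N' :=
  (mul_nonneg_iff_of_pos_right (pow_pos (lt_of_lt_of_le one_pos hl) s)).mp (hMs.trans h)

/-- **`((4^{n_β})^{10} ≤ β^{10}/2^{65}`** (fifth power of `l_sq_le`). [cite: BenfattoGiulianiMastropietro2006, §2.3 (2.21)] -/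
theorem l_pow_ten_le {β : ℝ} (hβ : klBetaMin ≤ β) : ((4 : ℝ) ^ nScales β) ^ 10 ≤ β ^ 10 / 2 ^ 65 := by
  have h := l_sq_le hβ
  have h0 : 0 ≤ ((4 : ℝ) ^ nScales β) ^ 2 := by positivity
  have h5 := pow_le_pow_left₀ h0 h 5
  have e1 : (((4 : ℝ) ^ nScales β) ^ 2) ^ 5 = ((4 : ℝ) ^ nScales β) ^ 10 := by rw [← pow_mul]
  have e2 : (β ^ 2 / 2 ^ 13) ^ 5 = β ^ 10 / 2 ^ 65 := by rw [div_pow, ← pow_mul]; norm_num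
  rwa [e1, e2] at h5

/-- **`4^{n_β}·(4/L) ≤ 1` at the registered volume door** `klEngL₄ P R β U ≤ L` (`4·4^{n_β} ≤ β/(8π) ≤ β ≤ 2^{10}β²/U² ≤ klEngL₃ ≤ klEngL₄`).
[cite: BenfattoGiulianiMastropietro2006, §2.3 (2.21)] -/
theorem four_pow_nScales_mul_four_div_le_one {P : SplitConsts} {R : RenConsts} {β U : ℝ} (hβ : klBetaMin ≤ β) (hU : 0 < U) (hU1 : U ≤ 1)
    {L : ℕ} (hL : klEngL₄ P R β U ≤ L) : (4 : ℝ) ^ nScales β * (4 / (L : ℝ)) ≤ 1 := by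
  have h128 : (128 : ℝ) ≤ β := by simpa [klBetaMin] using hβ
  have h4 := four_pow_nScales_le hβ
  have hL3 : (klEngL₃ β U : ℝ) ≤ (L : ℝ) := by exact_mod_cast (klEngL₃_le_of_klEngL₄_le hL)
  have hsq := sq_div_sq_le_klEngL₃ (β := β) hU
  have hU2 : U ^ 2 ≤ 1 := by nlinarith
  have hβ2 : 2 ^ 10 * β ^ 2 ≤ 2 ^ 10 * β ^ 2 / U ^ 2 := by
    rw [le_div_iff₀ (by positivity)]
    nlinarith [sq_nonneg β]
  have hLβ : β ≤ (L : ℝ) := by nlinarith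
  have hπ : klE0 * β / π ≤ β / 4 := by
    rw [klE0, div_le_div_iff₀ Real.pi_pos (by norm_num : (0:ℝ) < 4)]
    nlinarith [Real.pi_gt_three]
  have hLpos : (0 : ℝ) < L := by linarith
  rw [mul_div_assoc', div_le_one hLpos]
  linarith

/-! ## §2 The graded far part, row bound and envelope (abstract variables) -/

/-- **Far part, channels `b`/`c`, GRADED**: `L²Lʲ·((P²(0!)²ρ₄⁰ + 2(P(0!)²ρ₃⁰))·(Ms/(1+L/4)^s)) ≤ N′·l^{10}·((285/4)·4⁶·X⁴)` for `Ms ≤ N′·lˢ`, `1 ≤ l`,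
`l·(4/L) ≤ 1`, `4/L ≤ X`, `10 ≤ s`, `4 ≤ L` (keeps `(l·4/L)^{s−10} ≤ 1` instead of `(4/L)^{s−10} ≤ 1`). [cite: BenfattoGiulianiMastropietro2006, §2.3 (2.24)] -/
theorem farPartB_le_graded {L : ℕ} (hL4 : 4 ≤ L) {P ρ₃ ρ₄ X Ms l N' : ℝ} {j s : ℕ} (hP0 : 0 ≤ P) (hP : P ≤ 15 / 2) (hMs : 0 ≤ Ms) (hl : 1 ≤ l)
    (hMs' : Ms ≤ N' * l ^ s) (hlL : l * (4 / (L : ℝ)) ≤ 1) (hj : j ≤ 4) (hs : 10 ≤ s) (h4L : 4 / (L : ℝ) ≤ X) :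
    (L : ℝ) ^ 2 * (L : ℝ) ^ j * ((P * P * ((0 ! : ℝ)) ^ 2 * ρ₄ ^ 0 + 2 * (P * ((0 ! : ℝ)) ^ 2 * ρ₃ ^ 0)) * (Ms / (1 + (L : ℝ) / 4) ^ s)) ≤
      N' * l ^ 10 * (285 / 4 * 4 ^ 6 * X ^ 4) := by
  have hLr : (4 : ℝ) ≤ L := by exact_mod_cast hL4
  have hLpos : (0 : ℝ) < L := by linarith
  have hq0 : 0 ≤ 4 / (L : ℝ) := by positivity
  have hl0 : 0 ≤ l := zero_le_one.trans hl
  have hN'0 : 0 ≤ N' := nonneg_of_le_mul_pow hMs hl hMs'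
  have hA : P * P * ((0 ! : ℝ)) ^ 2 * ρ₄ ^ 0 + 2 * (P * ((0 ! : ℝ)) ^ 2 * ρ₃ ^ 0) = P * P + 2 * P := by simp [Nat.factorial]
  rw [hA]
  have hPP0 : 0 ≤ P * P + 2 * P := by positivity
  have hPP : P * P + 2 * P ≤ 285 / 4 := by nlinarith
  have h := far_weight_le hL4 hPP0 hMs hj (show 6 ≤ s by omega)
  -- `Ms·(4/L)^{s−6} ≤ N′·l^{10}·X⁴`
  obtain ⟨t, rfl⟩ : ∃ t, s = 10 + t := ⟨s - 10, by omega⟩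
  have e1 : (4 / (L : ℝ)) ^ (10 + t - 6) = (4 / (L : ℝ)) ^ 4 * (4 / (L : ℝ)) ^ t := by
    rw [show 10 + t - 6 = 4 + t by omega, pow_add]
  have hlt : (l * (4 / (L : ℝ))) ^ t ≤ 1 := pow_le_one₀ (mul_nonneg hl0 hq0) hlL
  have hq4 : (4 / (L : ℝ)) ^ 4 ≤ X ^ 4 := pow_le_pow_left₀ hq0 h4L 4
  have hkey : Ms * (4 / (L : ℝ)) ^ (10 + t - 6) ≤ N' * l ^ 10 * X ^ 4 := by
    rw [e1]
    calc Ms * ((4 / (L : ℝ)) ^ 4 * (4 / (L : ℝ)) ^ t) ≤ (N' * l ^ (10 + t)) * ((4 / (L : ℝ)) ^ 4 * (4 / (L : ℝ)) ^ t) :=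
          mul_le_mul_of_nonneg_right hMs' (by positivity)
      _ = N' * l ^ 10 * (4 / (L : ℝ)) ^ 4 * (l * (4 / (L : ℝ))) ^ t := by rw [pow_add, mul_pow]; ring
      _ ≤ N' * l ^ 10 * X ^ 4 * 1 := by
          exact mul_le_mul (mul_le_mul_of_nonneg_left hq4 (by positivity)) hlt (by positivity) (by positivity)
      _ = N' * l ^ 10 * X ^ 4 := mul_one _
  calc (L : ℝ) ^ 2 * (L : ℝ) ^ j * ((P * P + 2 * P) * (Ms / (1 + (L : ℝ) / 4) ^ (10 + t)))
      ≤ (P * P + 2 * P) * Ms * 4 ^ 6 * (4 / (L : ℝ)) ^ (10 + t - 6) := h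
    _ = (P * P + 2 * P) * 4 ^ 6 * (Ms * (4 / (L : ℝ)) ^ (10 + t - 6)) := by ring
    _ ≤ 285 / 4 * 4 ^ 6 * (N' * l ^ 10 * X ^ 4) :=
        mul_le_mul (mul_le_mul_of_nonneg_right hPP (by norm_num)) hkey (mul_nonneg hMs (pow_nonneg hq0 _)) (by positivity)
    _ = N' * l ^ 10 * (285 / 4 * 4 ^ 6 * X ^ 4) := by ring

/-- **Row bound, channels `b`/`c`, GRADED**: `Mm·(1869885·Q) + N′·l^{10}·((285/4)·4⁶·X⁴) ≤ Mm·(Rsq⁸U¹⁸/(2⁶β²)) + N′·(U⁴/(2^282β²))` at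
`Q = Rsq⁸U¹⁸/(2^27β²)`, `0 ≤ X ≤ U/(2^59β³)`, `l^{10} ≤ β^{10}/2^{65}`. [cite: BenfattoGiulianiMastropietro2006, §2.3 (2.24)] -/
theorem rowBoundB_le_graded {Rsq U β X Mm N' l : ℝ} (hβ : 128 ≤ β) (hX0 : 0 ≤ X) (hX : X ≤ U / (2 ^ 59 * β ^ 3))
    (hMm : 0 ≤ Mm) (hN' : 0 ≤ N') (hl10 : l ^ 10 ≤ β ^ 10 / 2 ^ 65) :
    Mm * (1869885 * (Rsq ^ 8 * U ^ 18 / (2 ^ 27 * β ^ 2))) + N' * l ^ 10 * (285 / 4 * 4 ^ 6 * X ^ 4) ≤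
      Mm * (Rsq ^ 8 * U ^ 18 / (2 ^ 6 * β ^ 2)) + N' * (U ^ 4 / (2 ^ 282 * β ^ 2)) := by
  have hβ0 : 0 < β := by linarith
  have hX4 : X ^ 4 ≤ (U / (2 ^ 59 * β ^ 3)) ^ 4 := pow_le_pow_left₀ hX0 hX 4
  have hb : (U / (2 ^ 59 * β ^ 3)) ^ 4 = U ^ 4 / (2 ^ 236 * β ^ 12) := by rw [div_pow, mul_pow]; ring
  have h1 : 1869885 * (Rsq ^ 8 * U ^ 18 / (2 ^ 27 * β ^ 2)) ≤ Rsq ^ 8 * U ^ 18 / (2 ^ 6 * β ^ 2) := by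
    rw [mul_div_assoc', div_le_div_iff₀ (by positivity) (by positivity)]
    have : 0 ≤ Rsq ^ 8 * U ^ 18 * β ^ 2 := by positivity
    nlinarith
  have h2 : l ^ 10 * (285 / 4 * 4 ^ 6 * X ^ 4) ≤ U ^ 4 / (2 ^ 282 * β ^ 2) := by
    have hXb : 285 / 4 * 4 ^ 6 * X ^ 4 ≤ 2 ^ 19 * (U ^ 4 / (2 ^ 236 * β ^ 12)) := by
      calc 285 / 4 * 4 ^ 6 * X ^ 4 ≤ 285 / 4 * 4 ^ 6 * (U ^ 4 / (2 ^ 236 * β ^ 12)) := by rw [← hb]; gcongr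
        _ ≤ 2 ^ 19 * (U ^ 4 / (2 ^ 236 * β ^ 12)) := by gcongr; norm_num
    calc l ^ 10 * (285 / 4 * 4 ^ 6 * X ^ 4) ≤ (β ^ 10 / 2 ^ 65) * (2 ^ 19 * (U ^ 4 / (2 ^ 236 * β ^ 12))) :=
          mul_le_mul hl10 hXb (by positivity) (by positivity)
      _ = U ^ 4 / (2 ^ 282 * β ^ 2) := by field_simp
  have hA := mul_le_mul_of_nonneg_left h1 hMm
  have hB := mul_le_mul_of_nonneg_left h2 hN'
  calc Mm * (1869885 * (Rsq ^ 8 * U ^ 18 / (2 ^ 27 * β ^ 2))) + N' * l ^ 10 * (285 / 4 * 4 ^ 6 * X ^ 4)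
      = Mm * (1869885 * (Rsq ^ 8 * U ^ 18 / (2 ^ 27 * β ^ 2))) + N' * (l ^ 10 * (285 / 4 * 4 ^ 6 * X ^ 4)) := by ring
    _ ≤ Mm * (Rsq ^ 8 * U ^ 18 / (2 ^ 6 * β ^ 2)) + N' * (U ^ 4 / (2 ^ 282 * β ^ 2)) := add_le_add hA hB

/-- **Graded envelope, GRADED `s`-row form**: `Mm·(Rsq⁸U¹⁸/(2⁶β²)) + N′·(U⁴/(2^282β²)) ≤ (N·Rsq⁸/2⁶ + N′/2^282)·(U³/β²)·lʲ` for `Mm ≤ N·lʲ`,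
`0 ≤ N′`, `0 ≤ U ≤ 1`, `128 ≤ β`, `1 ≤ l`. [cite: BenfattoGiulianiMastropietro2006, §2.3 (2.24)] -/
theorem graded_envelope_le_graded {Rsq U β l Mm N N' : ℝ} {j : ℕ} (hU0 : 0 ≤ U) (hU1 : U ≤ 1) (hβ : 128 ≤ β) (hl : 1 ≤ l)
    (hMm0 : 0 ≤ Mm) (hN'0 : 0 ≤ N') (hMm : Mm ≤ N * l ^ j) :
    Mm * (Rsq ^ 8 * U ^ 18 / (2 ^ 6 * β ^ 2)) + N' * (U ^ 4 / (2 ^ 282 * β ^ 2)) ≤ (N * Rsq ^ 8 / 2 ^ 6 + N' / 2 ^ 282) * (U ^ 3 / β ^ 2) * l ^ j := by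
  have hβ0 : 0 < β := by linarith
  have hlj : 1 ≤ l ^ j := one_le_pow₀ hl
  have hU18 : U ^ 18 ≤ U ^ 3 := pow_le_pow_of_le_one hU0 hU1 (by norm_num)
  have hU4 : U ^ 4 ≤ U ^ 3 := pow_le_pow_of_le_one hU0 hU1 (by norm_num)
  have hV0 : 0 ≤ U ^ 3 / β ^ 2 := by positivity
  have hA : Rsq ^ 8 * U ^ 18 / (2 ^ 6 * β ^ 2) ≤ Rsq ^ 8 / 2 ^ 6 * (U ^ 3 / β ^ 2) := by
    rw [div_le_iff₀ (by positivity)]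
    have e : Rsq ^ 8 / 2 ^ 6 * (U ^ 3 / β ^ 2) * (2 ^ 6 * β ^ 2) = Rsq ^ 8 * U ^ 3 := by field_simp
    rw [e]
    exact mul_le_mul_of_nonneg_left hU18 (by positivity)
  have hA0 : 0 ≤ Rsq ^ 8 * U ^ 18 / (2 ^ 6 * β ^ 2) := by positivity
  have hB : U ^ 4 / (2 ^ 282 * β ^ 2) ≤ 1 / 2 ^ 282 * (U ^ 3 / β ^ 2) := by
    rw [div_le_iff₀ (by positivity)]
    have e : 1 / 2 ^ 282 * (U ^ 3 / β ^ 2) * (2 ^ 282 * β ^ 2) = U ^ 3 := by field_simp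
    rw [e]
    exact hU4
  have hN0 : 0 ≤ N * l ^ j := hMm0.trans hMm
  have h1 : Mm * (Rsq ^ 8 * U ^ 18 / (2 ^ 6 * β ^ 2)) ≤ (N * l ^ j) * (Rsq ^ 8 / 2 ^ 6 * (U ^ 3 / β ^ 2)) := mul_le_mul hMm hA hA0 hN0
  have h2 : N' * (U ^ 4 / (2 ^ 282 * β ^ 2)) ≤ N' * (1 / 2 ^ 282 * (U ^ 3 / β ^ 2)) := mul_le_mul_of_nonneg_left hB hN'0
  have h3 : N' * (1 / 2 ^ 282 * (U ^ 3 / β ^ 2)) ≤ N' * (1 / 2 ^ 282 * (U ^ 3 / β ^ 2)) * l ^ j :=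
    le_mul_of_one_le_right (by positivity) hlj
  calc Mm * (Rsq ^ 8 * U ^ 18 / (2 ^ 6 * β ^ 2)) + N' * (U ^ 4 / (2 ^ 282 * β ^ 2))
      ≤ (N * l ^ j) * (Rsq ^ 8 / 2 ^ 6 * (U ^ 3 / β ^ 2)) + N' * (1 / 2 ^ 282 * (U ^ 3 / β ^ 2)) * l ^ j := by linarith
    _ = (N * Rsq ^ 8 / 2 ^ 6 + N' / 2 ^ 282) * (U ^ 3 / β ^ 2) * l ^ j := by ring

/-! ## §3 The literal channel-`b`/`c` row with the graded `s`-envelope -/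

section Rows

variable {P : SplitConsts} {R : RenConsts} (hR : ∀ j, 0 ≤ R.Gfr j) (hR0 : 0 < R.Gfr 0) {W : ℝ} (hW : 0 ≤ W) {β U : ℝ} (hβ : klBetaMin ≤ β)
  (hU : 0 < U) (hU1 : U ≤ 1) {Ξ Θ : ℝ}
  (hΞ : Ξ = (2 ^ 10 * (1 + Real.pi ^ 8 * (W * U ^ 2) / 2 ^ 11) + ∑ j ∈ range 5, R.Gfr j))
  (hΘ : Θ = (1 + ((∑ j ∈ range 5, R.Gfr j) + Real.pi ^ 8 * W / 2 ^ 11) * |U| / R.Gfr 0))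
  (hdoor : R.Gfr 0 * |U| + ((∑ j ∈ range 5, R.Gfr j) + Real.pi ^ 8 * W / 2 ^ 11) * U ^ 2 ≤ 1 / 512) {L : ℕ} [NeZero L] (hL : klEngL₄ P R β U ≤ L)
  {s : ℕ} (hs : 10 ≤ s) {j : ℕ} (hj : j ≤ 4)
include hR hR0 hW hβ hU hU1 hΞ hΘ hdoor hL hs hj

/-- **The channel-`b`/`c` alias row at `Mg = 26`, `√Rsq` form, GRADED `s`-ENVELOPE**: same left-hand side as `lastAliasRowB_le_sqrt`; under
`Ms ≤ N′·((4:ℝ)^{n_β})^s` it is `≤ Mm·(√(klEngRsq R)⁸U¹⁸/(2⁶β²)) + N′·(U⁴/(2^282β²))`. [cite: BenfattoGiulianiMastropietro2006, §2.3 (2.24)] -/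
theorem lastAliasRowB_le_graded {Mm Ms : ℝ} (hMm : 0 ≤ Mm) (hMs : 0 ≤ Ms) {N' : ℝ} (hMs' : Ms ≤ N' * ((4 : ℝ) ^ nScales β) ^ s) :
    2 * (2 * (Mm * ((3 : ℝ) ^ j * (((R.Gfr 0 * |U| * Θ * ((16 : ℝ) ^ nScales β)⁻¹) / |(β * (L : ℝ) ^ 2)| * ((5 : ℝ) * (|(β * (L : ℝ) ^ 2)| * (6 / (klScale klE0 (nScales β + 1)))))) *
      ((R.Gfr 0 * |U| * Θ * ((16 : ℝ) ^ nScales β)⁻¹) / |(β * (L : ℝ) ^ 2)| * ((5 : ℝ) * (|(β * (L : ℝ) ^ 2)| * (6 / (klScale klE0 (nScales β + 1)))))) * ((26 ! : ℝ)) ^ 2 * (2 * (2 *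
      (2 * (2 ^ 10 * (1 : ℝ) * (4 : ℝ) ^ nScales β) + 2 * (4 * (2 * (4 * (4 + (4 : ℝ) ^ nScales β * Ξ) * (1 + 16 * (1 + (27 / 10 : ℝ)) / (klScale klE0 (nScales β + 1)) * 1) + (2 ^ 10 *
      (1 : ℝ) * (4 : ℝ) ^ nScales β))) * (1 + 6 / (klScale klE0 (nScales β + 1)) * ((klScale klE0 (nScales β + 1)) / 128 + (5 : ℝ) * (R.Gfr 0 * |U| * Θ * ((16 : ℝ) ^ nScales
      β)⁻¹))))))) ^ 26 + 2 * (((R.Gfr 0 * |U| * Θ * ((16 : ℝ) ^ nScales β)⁻¹) / |(β * (L : ℝ) ^ 2)|) * ((5 : ℝ) * (|(β * (L : ℝ) ^ 2)| * (6 / (klScale klE0 (nScales β + 1))))) * ((26 !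
      : ℝ)) ^ 2 * (2 * (2 * (2 ^ 10 * (1 : ℝ) * (4 : ℝ) ^ nScales β) + 2 * (4 * (2 * (4 * (4 + (4 : ℝ) ^ nScales β * Ξ) * (1 + 16 * (1 + (27 / 10 : ℝ)) / (klScale klE0 (nScales β + 1))
      * 1) + (2 ^ 10 * (1 : ℝ) * (4 : ℝ) ^ nScales β))) * (1 + 6 / (klScale klE0 (nScales β + 1)) * ((klScale klE0 (nScales β + 1)) / 128 + (5 : ℝ) * (R.Gfr 0 * |U| * Θ * ((16 : ℝ) ^
      nScales β)⁻¹)))))) ^ 26)) * (2 / ((2 * (L / 4 + 1) : ℕ) : ℝ)) ^ (26 - j - 4) * (2 ^ 2 * ∑' k : Fin 2 → ℤ, ∏ i, (1 + (k i : ℝ) ^ 2)⁻¹)))) + (L : ℝ) ^ 2 * (L : ℝ) ^ j * ((((R.Gfr 0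
      * |U| * Θ * ((16 : ℝ) ^ nScales β)⁻¹) / |(β * (L : ℝ) ^ 2)| * ((5 : ℝ) * (|(β * (L : ℝ) ^ 2)| * (6 / (klScale klE0 (nScales β + 1)))))) * ((R.Gfr 0 * |U| * Θ * ((16 : ℝ) ^
      nScales β)⁻¹) / |(β * (L : ℝ) ^ 2)| * ((5 : ℝ) * (|(β * (L : ℝ) ^ 2)| * (6 / (klScale klE0 (nScales β + 1)))))) * ((0 ! : ℝ)) ^ 2 * (2 * (2 * (2 * (2 ^ 10 * (1 : ℝ) * (4 : ℝ) ^
      nScales β) + 2 * (4 * (2 * (4 * (4 + (4 : ℝ) ^ nScales β * Ξ) * (1 + 16 * (1 + (27 / 10 : ℝ)) / (klScale klE0 (nScales β + 1)) * 1) + (2 ^ 10 * (1 : ℝ) * (4 : ℝ) ^ nScales β))) *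
      (1 + 6 / (klScale klE0 (nScales β + 1)) * ((klScale klE0 (nScales β + 1)) / 128 + (5 : ℝ) * (R.Gfr 0 * |U| * Θ * ((16 : ℝ) ^ nScales β)⁻¹))))))) ^ 0 + 2 * (((R.Gfr 0 * |U| * Θ *
      ((16 : ℝ) ^ nScales β)⁻¹) / |(β * (L : ℝ) ^ 2)|) * ((5 : ℝ) * (|(β * (L : ℝ) ^ 2)| * (6 / (klScale klE0 (nScales β + 1))))) * ((0 ! : ℝ)) ^ 2 * (2 * (2 * (2 ^ 10 * (1 : ℝ) * (4 :
      ℝ) ^ nScales β) + 2 * (4 * (2 * (4 * (4 + (4 : ℝ) ^ nScales β * Ξ) * (1 + 16 * (1 + (27 / 10 : ℝ)) / (klScale klE0 (nScales β + 1)) * 1) + (2 ^ 10 * (1 : ℝ) * (4 : ℝ) ^ nScales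
      β))) * (1 + 6 / (klScale klE0 (nScales β + 1)) * ((klScale klE0 (nScales β + 1)) / 128 + (5 : ℝ) * (R.Gfr 0 * |U| * Θ * ((16 : ℝ) ^ nScales β)⁻¹)))))) ^ 0)) * (Ms / (1 + (L : ℝ)
      / 4) ^ s)) ≤
      Mm * (Real.sqrt (klEngRsq R) ^ 8 * U ^ 18 / (2 ^ 6 * β ^ 2)) + N' * (U ^ 4 / (2 ^ 282 * β ^ 2)) := by
  have h128 : (128 : ℝ) ≤ β := by simpa [klBetaMin] using hβ
  have hβ0 : (0 : ℝ) < β := by linarith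
  have hLr := klEngL4Real_le_of_klEngL₄_le hL
  have hL4 := four_le_of_klEngL4Real_le hβ hU hU1 hLr
  have hl1 : (1 : ℝ) ≤ (4 : ℝ) ^ nScales β := one_le_pow₀ (by norm_num)
  have hlL : (4 : ℝ) ^ nScales β * (4 / (L : ℝ)) ≤ 1 := four_pow_nScales_mul_four_div_le_one hβ hU hU1 hL
  have hPR : 1 ≤ klEngPsq P ^ 2 * klEngRsq R ^ 2 := one_le_mul_of_one_le_of_one_le (one_le_pow₀ (one_le_klEngPsq P)) (one_le_pow₀ (one_le_klEngRsq R))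
  have hX : U / (2 ^ 59 * klEngPsq P ^ 2 * klEngRsq R ^ 2 * β ^ 3) ≤ U / (2 ^ 59 * β ^ 3) := by
    refine div_le_div_of_nonneg_left hU.le (by positivity) ?_
    nlinarith [pow_pos hβ0 3]
  have hX0 : 0 ≤ U / (2 ^ 59 * klEngPsq P ^ 2 * klEngRsq R ^ 2 * β ^ 3) := by
    have hPRp : 0 < klEngPsq P ^ 2 * klEngRsq R ^ 2 := mul_pos (pow_pos (klEngPsq_pos P) 2) (pow_pos (klEngRsq_pos R) 2)
    have hden : 0 < 2 ^ 59 * klEngPsq P ^ 2 * klEngRsq R ^ 2 * β ^ 3 := by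
      have := mul_pos (mul_pos hPRp (pow_pos hβ0 3)) (by norm_num : (0 : ℝ) < 2 ^ 59); linarith
    exact div_nonneg hU.le hden.le
  have hΞ0 : 0 ≤ Ξ := by rw [hΞ]; exact Xi_nonneg hR hW U
  have hΘ0 : 0 ≤ Θ := by rw [hΘ]; exact Theta_nonneg hR hR0 hW U
  have hδΛ : R.Gfr 0 * |U| * Θ * ((16 : ℝ) ^ nScales β)⁻¹ ≤ klScale klE0 (nScales β + 1) / 4 := by
    rw [hΘ]; exact Gfr_mul_Theta_inv_pow_le_klScale_succ_div_four hR0 hdoor (nScales β)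
  have hc : (β * (L : ℝ) ^ 2) ≠ 0 := by
    have hL1 : (1 : ℝ) ≤ L := by exact_mod_cast Nat.one_le_iff_ne_zero.2 (NeZero.ne L)
    positivity
  obtain ⟨hPb, hPb0⟩ := lastPrefB_le (c := (β * (L : ℝ) ^ 2)) (hR 0) hc hΘ0 (nScales β) hδΛ
  have hρ3 := lastRatio₃_le (hR 0) hΞ0 hΘ0 zero_le_one (nScales β) hδΛ (U := U)
  have hρ30 := lastRatio₃_nonneg (hR 0) hΞ0 hΘ0 zero_le_one (nScales β) hδΛ (U := U)
  have hρ4 := lastRatio₄_le (hR 0) hΞ0 hΘ0 zero_le_one (nScales β) hδΛ (U := U)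
  have hρ40 : 0 ≤ 2 * (2 * (2 * (2 ^ 10 * (1 : ℝ) * (4 : ℝ) ^ nScales β) + 2 * (4 * (2 * (4 * (4 + (4 : ℝ) ^ nScales β * Ξ) * (1 + 16 * (1 + (27 / 10 : ℝ)) / (klScale klE0 (nScales β + 1)) * 1) + (2 ^
      10 * (1 : ℝ) * (4 : ℝ) ^ nScales β))) * (1 + 6 / (klScale klE0 (nScales β + 1)) * ((klScale klE0 (nScales β + 1)) / 128 + (5 : ℝ) * (R.Gfr 0 * |U| * Θ * ((16 : ℝ) ^ nScales
      β)⁻¹)))))) := mul_nonneg (by norm_num) hρ30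
  obtain ⟨hρ3r, hρ3B, hE0, hE⟩ := lastAliasLawSqrt (P := P) hR hW hβ hU hΞ (hdoor.trans (by norm_num)) hLr (Nat.le_succ _) hρ3
  obtain ⟨hρ4r, hρ4B, -, -⟩ := lastAliasLawSqrt (P := P) hR hW hβ hU hΞ (hdoor.trans (by norm_num)) hLr (Nat.le_succ _) hρ4
  have hQ := gevreyRow26_le_of_le (U := U) hβ hE0 hE
  obtain ⟨hS, hS0⟩ := aliasS_le
  obtain ⟨hr1, hr0⟩ := aliasR_le_one L
  have halias := aliasPartB_le hj hPb0 hPb hρ30 hρ40 hr0 hr1 hρ3r hρ3B hρ4r hρ4B hS0 hS hQ hMm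
  have h4L := four_div_le_of_klEngL4Real_le (P := P) (R := R) hU hβ0 hLr
  have hfar := farPartB_le_graded hL4 hPb0 hPb hMs hl1 hMs' hlL hj hs h4L
    (ρ₃ := (2 * (2 * (2 ^ 10 * (1 : ℝ) * (4 : ℝ) ^ nScales β) + 2 * (4 * (2 * (4 * (4 + (4 : ℝ) ^ nScales β * Ξ) * (1 + 16 * (1 + (27 / 10 : ℝ)) / (klScale klE0 (nScales β + 1)) * 1) + (2 ^
      10 * (1 : ℝ) * (4 : ℝ) ^ nScales β))) * (1 + 6 / (klScale klE0 (nScales β + 1)) * ((klScale klE0 (nScales β + 1)) / 128 + (5 : ℝ) * (R.Gfr 0 * |U| * Θ * ((16 : ℝ) ^ nScales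
      β)⁻¹)))))))
    (ρ₄ := 2 * (2 * (2 * (2 ^ 10 * (1 : ℝ) * (4 : ℝ) ^ nScales β) + 2 * (4 * (2 * (4 * (4 + (4 : ℝ) ^ nScales β * Ξ) * (1 + 16 * (1 + (27 / 10 : ℝ)) / (klScale klE0 (nScales β + 1)) * 1) + (2 ^
      10 * (1 : ℝ) * (4 : ℝ) ^ nScales β))) * (1 + 6 / (klScale klE0 (nScales β + 1)) * ((klScale klE0 (nScales β + 1)) / 128 + (5 : ℝ) * (R.Gfr 0 * |U| * Θ * ((16 : ℝ) ^ nScales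
      β)⁻¹)))))))
  have hN'0 : 0 ≤ N' := nonneg_of_le_mul_pow hMs hl1 hMs'
  have hrow := rowBoundB_le_graded (Rsq := Real.sqrt (klEngRsq R)) (Mm := Mm) (N' := N') h128 hX0 hX hMm hN'0 (l_pow_ten_le hβ)
  exact (add_le_add halias hfar).trans hrow


end Rows

end Summit.HubbardSuperconductivity.HubbardSuperconductivity.Theorems.EngineV8

end
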